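import Mathlib
import Summits.Ventures.HodgeRepro2.T6N5FockCarrier

/-!
# T6N5FockHyp — the two displays of the FockDict discharge chain (route/T6-N5-t6-p7.md §14): Konno–Konno
2007 Fact 5.1 (the joint harmonics and the Howe correspondence, compact case) and Theorem 5.4(i) (the K-type
correspondence) at lines — Tier 6 (README §10.2), sub-step N5 (t6-p7)

Two displays, `def … : Prop` in the free parameter `C : KTypeCarrier` (the (U(1),U(1)) K-type carrier of
`T6N5FockCarrier.lean`, p411341), each DEFINITIONALLY the interface Prop it displays (`HoweCompact C`,
`KTypeHalfLine C`), so that `N5Fock.fockDictCO_of_carrier` consumes them by name.  Docstrings from t6-lit's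
cards C61 / C62 (route/T6-LIT-SOURCES.md v0.85+, STATUS l. 11707): the prose of both statements is quoted
EXACT-AS-RESTORED (QA-t6lit-85 / 86: whitespace normalised; the layer's prime byte 0x03 written as ′;
sub/superscripts restored — J_{V,W,ξ} for the layer's «JV ,W,ξ», (g_{V,ℂ}, K_V) for «(gV ,C , KV )»,
ω_{W,ξ} for «ωW,ξ», b_{V,ψ} for «bV ,ψ»; the blackboard letters ℂ / ℤ for the layer's plain «C» / «Z»
(«C×», «Z>0» = ℂ^×, ℤ_{>0}); the layer's small-caps head artefact «T HEOREM 5.4.» quoted as its bytes in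
‹…› (printed «Theorem 5.4.»; the layer's «Fact 5.1.» carries no artefact); the detached labels of the layer
kept outside the quotes in [·])
from the HELD PRINT PAGE LAYER of the journal (lit store paper:doi-10-2206-kyushujm-61-35, Kyushu J. Math.
61 (2007), journal p. = layer p + 34; no render — `lit pull` is disabled in the cell, WANTED W-11 stands for
the J-STAGE print pages); the weight display (5.6) of Theorem 5.4 is EXPLODED in the layer and is given in
the card's re-typeset reading (structure reconstructed via Lemma 5.3(1)(i)), print pending W-11 — said so in
the docstring.  Statement lane: definitions and `#check` only.
§8(d): uses an L-value-free non-vanishing device: NO.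
-/

namespace Summit.Ventures.HodgeRepro2.T6.Hyp

open Summit.Ventures.HodgeRepro2.T6.N5Fock

/-- [cite: KonnoKonno2007, T. Konno, K. Konno, «On doubling construction for real unitary dual pairs», Kyushu
J. Math. 61 (2007), no. 1, 35–82, doi:10.2206/kyushujm.61.35, Fact 5.1 [How89, Section 3], journal p. 71
(held print page layer paper:doi-10-2206-kyushujm-61-35 p0037 ll. 52–71 — (1) l. 53; (2) ll. 54–59, the
bijection display ll. 58–59 with its ∋ as the byte 0x10; (3) ll. 60–71, its label «(3)» detached to l. 73;
primes as the byte 0x03 on ll. 69–70; t6-lit card C61; NO RENDER — W-11)] «Fact 5.1. [How89, Section 3]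
We have the following. (1) J_{V,W,ξ} is stable under ω_{V,W,ξ}(K_V × K_W). (2) We write R(K_V, J_{V,W,ξ})
for the set of K_V-types which appear as irreducible direct summands of J_{V,W,ξ}. Similarly we define
R(K_W, J_{V,W,ξ}) in the W-side. Then J_{V,W,ξ} is multiplicity free as a K_V × K_W-module, so that it
gives a bijection» ‹R(K_V, J_{V,W,ξ}) ∋ (τ_V ≃ θ_ξ(τ_W, K_V)) ←→ (θ_ξ(τ_V, K_W) ≃ τ_W) ∈ R(K_W, J_{V,W,ξ}).›
[(3), the label of the following assertion — detached to l. 73 in the layer] «For a K_V-type τ_V, we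
write deg_{W,ξ}(τ_V) for the minimum degree of polynomials in the
τ_V-isotypic subspace in P_{V,W,ξ}. (We set deg_{W,ξ}(τ_V) := ∞ if τ_V does not appear in P_{V,W,ξ}.) We
write R(G_V, ω_{W,ξ}) for the set of isomorphism classes of irreducible (g_{V,ℂ}, K_V)-modules which appear
as quotients of ω_{W,ξ}. A K_V-type τ_V of π_V ∈ R(G_V, ω_{W,ξ}) is of minimal (W, ξ)-degree if
deg_{W,ξ}(τ_V) is minimal among deg_{W,ξ}(τ) (τ runs through the set of K_V-types in π_V). Similar
definition applies to the W-side. (i) Suppose that τ_V is a K_V-type of π_V ∈ R(G_V, ω_{W,ξ}) of minimal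
(W, ξ)-degree. Then τ_V ∈ R(K_V, J_{V,W,ξ}).» ‹(ii) Furthermore, θ_ξ(τ_V, K_W) is a K_W-type of minimal
(V, ξ′)-degree in the Howe correspondent θ_ξ(π_V, W) ∈ R(G_W, ω_{V,ξ′}) of π_V.› «A similar assertion holds
in the W-side.» (the standing objects are the paper's §§2–5: the Fock model (ω_{V,W,ξ}, P_{V,W,ξ}) of the
Weil representation of the real unitary dual pair (U(V), U(W)) with the splitting ξ, its restrictions
ω_{W,ξ} to G_V = U(V) and ω_{V,ξ′} to G_W = U(W), the maximal compact subgroups K_V, K_W, and the space of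
joint harmonics J_{V,W,ξ} := H_V(K_W) ∩ H_W(K_V) of p0037 ll. 5–7) [display: the COMPACT, ONE-DIMENSIONAL
case — V a hermitian LINE of sign `sV`, W a skew-hermitian LINE of sign `sW`, ψ of sign `εψ`, so
G_V = K_V = U(1) and every irreducible (g_{V,ℂ}, K_V)-module is a character π_V = τ_V, indexed by its
b_{V,ψ}-highest weight `l : ℤ`; `C.occ sV sW εψ l` carries ‹τ_V ∈ R(K_V, J_{V,W,ξ})› and
`C.lift sV sW εψ l` carries ‹π_V ∈ R(G_V, ω_{W,ξ})› (a quotient of ω_{W,ξ} — the Howe lift of π_V is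
non-zero); the Prop states `lift ↔ occ` for every (sV, sW, εψ, l): the direction ⟹ is (3)(i) (a character
has a single K-type, which is of minimal degree); the direction ⟸ is (1) together with the definition of
R(G_V, ω_{W,ξ}) in (3) — a K_V-type occurring in J_{V,W,ξ} ⊆ P_{V,W,ξ} is, G_V = K_V being compact and
P_{V,W,ξ} a locally finite K_V-module, a direct summand and hence a quotient of ω_{W,ξ} — the elementary
step carried in this bracket; (2)'s bijection and (3)(ii) are NOT carried (not consumed); WEAKER than
print (compact, one-dimensional, one clause), marked] [residual: PO on the held print layer (journal p. 71,
prose clean); the J-STAGE render (W-11) would make the quote first-hand] [quote-audit: QA-t6lit-85 (EXACT-AS-RESTORED 3/3 + readings 4/4 on p411943's bytes,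
STATUS l. 11762); form nit (a) applied in this revision] -/
def KonnoKonno2007_Fact5_1_compact (C : KTypeCarrier) : Prop := HoweCompact C

#check @KonnoKonno2007_Fact5_1_compact

/-- [cite: KonnoKonno2007, T. Konno, K. Konno, «On doubling construction for real unitary dual pairs», Kyushu
J. Math. 61 (2007), no. 1, 35–82, doi:10.2206/kyushujm.61.35, Theorem 5.4(i) (K-type correspondence),
journal p. 75 (held print page layer paper:doi-10-2206-kyushujm-61-35 p0041 ll. 33–69: the preamble
ll. 33–37 and the prose ll. 38–39, 62–63, 65, 67–69 clean and byte-exact (l. 68's primes as the byte 0x03);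
the weight display (5.6) ll. 40–65 EXPLODED — re-typeset in the card's reading, structure reconstructed via
Lemma 5.3(1)(i), p0040 ll. 19–33; t6-lit card C62; NO RENDER — PRINT PENDING W-11)] «This gives the main
result of this section. Recall the sign ε_ψ = d_ψ/(|d_ψ|i) ∈ {±1}. We set» ‹(b_{V,ψ}, b_{W,ψ}) :=
(b̄_V, b_W) if ε_ψ = 1, (b_V, b̄_W) if ε_ψ = −1.› ‹T HEOREM 5.4. (K-type correspondence) We have the following.› (the layer's small-caps head
artefact; printed «Theorem 5.4.») «(i) Write the b_{V,ψ}-highest weight of a K_V-type τ_V as» ‹(5.6) = (m/2 + ε_ψ(q′ − p′)/2, …,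
m/2 + ε_ψ(q′ − p′)/2 ; m/2 + ε_ψ(p′ − q′)/2, …, m/2 + ε_ψ(p′ − q′)/2)› «+ ε_ψ(−a_1, …, −a_r, 0, …, 0,
b_s, …, b_1 ; −d_1, …, −d_u, 0, …, 0, c_t, …, c_1), (5.6) for some a_1 ≥ ··· ≥ a_r, b_1 ≥ ··· ≥ b_s,
c_1 ≥ ··· ≥ c_t, d_1 ≥ ··· ≥ d_u ∈ ℤ_{>0}. Then τ_V belongs to R(K_V, J_{V,W,ξ}) if and only if r + t ≤ p′,
s + u ≤ q′. In that case, the b_{W,ψ}-highest weight of θ_ξ(τ_V, K_W) is given by» ‹(5.7)› (the constant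
vector of (5.6) — p entries before «;», q entries after, (p, q) the signature of V and (p′, q′) that of W —
is re-typeset from the exploded layer; its structure is that of Lemma 5.3(1)(i)'s t_{V,ℂ}-weight of
Δ_{abcd} in the case d_ψ i < 0 = ε_ψ = 1 (p0040 ll. 19–33, 49–50: Δ_{abcd} ∈ J_{V,W,ξ} iff r + s ≤ p,
t + u ≤ q, r + t ≤ p′, s + u ≤ q′), which the theorem unifies with the sign ε_ψ; the symbol m is not
defined in a clean line of the layer — consistent with m = dim W; (5.7), the correspondent's weight, is not
carried; PRINT PENDING W-11) [display: the case of LINES — V hermitian of signature (p, q) with p + q = 1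
(`sV` = +1 for (1,0), −1 for (0,1)), W skew-hermitian of signature (p′, q′) with p′ + q′ = 1 (`sW` likewise),
so every size symbol (n, n′, m) equals 1 and the K_V-types are the characters of U(1), written by their
b_{V,ψ}-highest weight `l : ℤ`; the owner's DERIVATION from (5.6): for (p, q) = (1,0) the constraints force
t = u = 0 and r + s ≤ 1 with r ≤ p′, s ≤ q′, so l = (1 + ε_ψ(q′ − p′))/2 + ε_ψ·(−a_1 | 0 | b_1); for
(p, q) = (0,1) they force r = s = 0 and t + u ≤ 1 with t ≤ p′, u ≤ q′, so l = (1 + ε_ψ(p′ − q′))/2 +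
ε_ψ·(−d_1 | 0 | c_1); in all four cases R(K_V, J_{V,W,ξ}) = {l ≤ 0} when ε_ψ·sV·sW = +1 and {l ≥ 1} when
ε_ψ·sV·sW = −1 (the two half-lines of the two W's partition ℤ — the reading is the one of the two block
assignments consistent with the Epsilon Dichotomy); `C.occ sV sW εψ l` carries ‹τ_V ∈ R(K_V, J_{V,W,ξ})›;
the Prop states this membership criterion for every (sV, sW, εψ, l) — the (U(1),U(1)) instance and the
half-line form are derivations, not printed sentences (card C62); the correspondent (5.7) is not carried
(not consumed); WEAKER than print (lines only, membership only), marked] [residual: PO, PRINT PENDING —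
the journal pages 74–75 (W-11) are the witness for (5.6); until then this display is STRUCTURE
RECONSTRUCTED from the exploded layer and must be banded so] [quote-audit: QA-t6lit-86 (EXACT-AS-RESTORED 3/3 + readings on p411943's bytes, STATUS
l. 11762); form nits (b), (c) applied in this revision; (5.6) = card C62's re-typeset reading] -/
def KonnoKonno2007_Thm5_4_i_lines (C : KTypeCarrier) : Prop := KTypeHalfLine C

#check @KonnoKonno2007_Thm5_4_i_lines

end Summit.Ventures.HodgeRepro2.T6.Hyp
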